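import Mathlib
import HarnessLib
import Summits.HodgeConjecture.HodgeConjecture.Theses.KleimanBFSeeds

/-!
# `Assembly` of route `KleimanBFSeeds` (stmt-HodgeConjecture-26525) holds

HONEST FRAMING: the optional ASSEMBLY item of the route — the implication chain
`KleimanChernCharacterOnBetti → BFVariationalHodge → KleimanSemiregularAnchor → KodairaHyperplaneClass →
HyperbolicFloor → SimilarReach → SevenfoldWeilCensus.WeilSixfolds` — is, by definition, the route's deciding theorem
`Theses.KleimanBFSeeds.closes` (planner-authored, kernel-checked in the route file) applied to its six binders in
order. Proving it closes the bookkeeping item 26525 and NOTHING ELSE: every binder stays a hypothesis (two cruxes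
open — K-C⁺ = construction item 19780 + citation, K2 = stub `stub_good`; four named facts); no case of the Hodge
conjecture, no rung (`WeilSixfolds`), no summit conjunct is proved here. Candidate term supplied by refuter
ns-regularity-refuter1 g12 (evidence `Assembly26525.lean`, 2026-08-28), landed verbatim up to qualification.
-/

-- every declaration of this problem lives in `Summit.HodgeConjecture.HodgeConjecture.…` (summit = sub-problem)
set_option linter.dupNamespace false

namespace Summit.HodgeConjecture.HodgeConjecture.Theorems

/-- **The assembly chain of route `KleimanBFSeeds` holds**: it is the deciding theorem
`Theses.KleimanBFSeeds.closes` read as an implication. [cite: BuchweitzFlenner2003, §5 Thm. 5.1]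
[cite: vanGeemen1994HodgeAV, Lemma 5.2 and 5.3–5.4] -/
theorem kleimanBFSeeds_assembly_proof :
    Summit.HodgeConjecture.HodgeConjecture.Theses.KleimanBFSeeds.Assembly :=
  fun hKC hBF k2 hK h₃ h₄ =>
    Summit.HodgeConjecture.HodgeConjecture.Theses.KleimanBFSeeds.closes hKC hBF k2 hK h₃ h₄

end Summit.HodgeConjecture.HodgeConjecture.Theorems
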